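import Literature.Analysis.FluidPDE.BurgersVortexLayerSteady
import HarnessLib

/-!
# The stretched two-dimensional Navier–Stokes class of a strained shear layer

Analysis/FluidPDE definitions file (work item `defn-IsStretchedLayerNSSolutionOn`, wanted by route
`MarginalStabilityChain` of `AnomalousDissipation`, items `StrainedLayerLaw`, `StretchedVortexRows`,
which inline the notion with `γ = ΔU = 1`). Proofs about the Burgers layer member are in
`StretchedLayerNSBurgers`.

Coordinates `(x, y, z)`: `x` along the layer (period `L`), `y` across it (the compressive direction
of the strain), `z` the stretching axis. In the irrotational linear strain `U_s = (0, −γy, γz)`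
(Majda–Bertozzi 2002, (1.26); Gallay–Maekawa 2016, (1.18): `u = u_s + v`) the ansatz

  `V(t, x, y, z) = (u(t,x,y), v(t,x,y) − γy, γz)`,  `P = p(t,x,y) − γ²(y² + z²)/2`

reduces the three-dimensional Navier–Stokes equations EXACTLY to the **stretched two-dimensional
Navier–Stokes system** for `(u, v, p)` on `ℝ²`:

  `∂ₜu + u ∂ₓu + (v − γy) ∂_y u       = −∂ₓp + νΔu`,
  `∂ₜv + u ∂ₓv + (v − γy) ∂_y v − γ v = −∂_y p + νΔv`,
  `∂ₓu + ∂_y v = 0`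

(substitute: `∂ₜ(v − γy) + V·∇(v − γy) = ∂ₜv + u vₓ + (v − γy)(v_y − γ)` and
`−∂_y P + νΔ(v − γy) = −p_y + γ²y + νΔv`, the `γ²y` cancel; the `z`-equation reads `γ²z = γ²z`;
`div V = uₓ + v_y − γ + γ`). The vorticity `ω = vₓ − u_y` then obeys
`∂ₜω + u ωₓ + (v − γy) ω_y − γω = νΔω` (vortex stretching `γω` in a planar problem); its steady
nondimensional form is eq. (2.1) of Kerr 2024 / Kerr–Dold 1994, who study `x`-periodic steady
solutions with DECAYING perturbation velocity (our `ΔU = 0`; their `y, z` are our `z, y`). The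
`x`-INDEPENDENT members `u = U(t, y)`, `v = 0`, `p = const` are Majda–Bertozzi's strained shear
layers `Uₜ − γyU_y = νU_yy` (§1.4, eq. (1.34), Examples 1.7–1.8), with steady state the **Burgers
shear layer** `U_B(y) = ΔU(γ/2πν)^{1/2}∫₀^y e^{−γs²/2ν} ds = (ΔU/2) erf(y(γ/2ν)^{1/2})` (ibid.,
(1.47)–(1.48)) — in the tree as `burgersLayerProfile γ ν ΔU` (`BurgersVortexLayer`, where the same
profile is placed in `ℝ³` across `x₀`). The shear far field `u → ±ΔU/2` with `x`-periodic,
`x`-dependent `(u, v)` is the class of Beronov–Kida's 2-D stability analysis of this layer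
(Phys. Fluids 1996, §II; not held here — the route's source for the nonparallel class).

## Contents

* `StretchedLayer.dX/dY/lap/dT` — slice derivatives `∂ₓ, ∂_y, Δ = ∂ₓ² + ∂_y²` of curried plane
  fields `f x y` (Mathlib `deriv` of slices) and the ONE-SIDED time derivative within a time set
  `S` (Mathlib `derivWithin`, the convention of `timeDerivWithin`; `dT_eq_timeDerivWithin`);
  `contDiff_slice`, `dT_eq_of_subset`.
* `IsStretchedLayerNSSolutionOn S ν γ ΔU L u v p` — classical solutions of the system on the time
  set `S` (`u, v ∈ C²`, `p ∈ C¹` jointly on `S × ℝ²`), `L`-periodic in `x` (all three fields),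
  far field `u → ±ΔU/2`, `v → 0` as `y → ±∞` (every `t ∈ S`, every `x`); `.mono`.
  `IsSteadyStretchedLayerNSSolution ν γ ΔU L u v p` — the steady system for time-independent
  `u v p : ℝ → ℝ → ℝ`; `isSteadyStretchedLayerNSSolution_iff_const` (steady = constant in time).
* `layerDissipation ν L u v = (ν/L) ∫⁻_{x ∈ (0,L]} ∫⁻_y (uₓ² + u_y² + vₓ² + v_y²) : ℝ≥0∞` —
  dissipation per unit layer area of a time slice in excess of the uniform strain's
  (`ν|∇V|² = ν|∇(u,v)|² − 2νγ v_y + 2νγ²` and `∫ v_y dy = 0` under the far field);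
  `meanLayerDissipation` — its Cesàro `liminf_{T→∞} T⁻¹∫₀ᵀ`.
* `burgersShearLayer γ ν ΔU : ℝ → ℝ → ℝ → ℝ`, `(t, x, y) ↦ U_B(y)`. PROVED in
  `StretchedLayerNSBurgers`: it solves the system with `v = 0`, `p = const` (`γ, ν > 0`), the
  Gaussian-primitive form of `U_B`, and `layerDissipation ν L U_B 0 = ΔU²(νγ/4π)^{1/2}`.

## Design notes

* Regularity is the requester's classical one (`C²` velocity, `C¹` pressure, jointly on `S × ℝ²`,
  Mathlib `ContDiffOn` on `S ×ˢ univ`, one-sided in `t` at boundary points of `S` as in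
  `IsClassicalNSSolutionOn`), not `C^∞`. Initial data / continuity at an initial time are NOT part
  of the structure (statements add `u t₀ = …`, `ContinuousOn …`).
* The far field is pointwise in `x`, without rate; no integrability is imposed (the dissipation is
  an extended real; `layerDissipation` is meaningful for `L > 0`, junk `0`-ish otherwise).
* Not here: a formal bridge to `IsClassicalNSSolutionOn` on `ℝ³` (that structure is `C^∞`; the
  reduction is the computation above), the vorticity form, Beronov–Kida's linearisation.

## References

* A. J. Majda, A. L. Bertozzi, *Vorticity and Incompressible Flow*, CUP 2002, §1.4: eqs. (1.26),
  (1.34)–(1.35), Examples 1.5–1.8, (1.47)–(1.48) (book pp. 16–19). [MajdaBertozzi2002]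
* Th. Gallay, Y. Maekawa, arXiv:1610.08384, §1, (1.18)–(1.22). [GallayMaekawa2016]
* O. S. Kerr, J. W. Dold, JFM 276 (1994) 307–325 [KerrDold1994]; O. S. Kerr, arXiv:2409.09695, §2,
  eqs. (2.1)–(2.4). [Kerr2024]
* K. N. Beronov, S. Kida, Phys. Fluids 8 (1996) 1024–1035, §II. [BeronovKida1996]
-/
noncomputable section

open Set Function Filter Topology MeasureTheory intervalIntegral
open scoped ENNReal ContDiff

namespace Literature.Analysis.FluidPDE

/-! ### Slice derivatives of curried plane fields -/

namespace StretchedLayer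

/-- `∂ₓ f (x, y)` for a curried plane field `f : ℝ → ℝ → ℝ`: the derivative of the slice
`s ↦ f s y` at `x` (Mathlib `deriv`; junk value `0` where the slice is not differentiable). [folklore] -/
def dX (f : ℝ → ℝ → ℝ) (x y : ℝ) : ℝ :=
  deriv (fun s => f s y) x

/-- `∂_y f (x, y)`: the derivative of the slice `s ↦ f x s` at `y`. [folklore] -/
def dY (f : ℝ → ℝ → ℝ) (x y : ℝ) : ℝ :=
  deriv (fun s => f x s) y

/-- The plane Laplacian `Δf = ∂ₓ∂ₓf + ∂_y∂_yf` from iterated slice derivatives (for `C²` fields this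
is the usual Laplacian). [folklore] -/
def lap (f : ℝ → ℝ → ℝ) (x y : ℝ) : ℝ :=
  dX (dX f) x y + dY (dY f) x y

/-- The ONE-SIDED time derivative `∂ₜu (t, x, y)` within the time set `S` of a time-dependent plane
field `u t x y` (time first): Mathlib `derivWithin`, the convention of the tree's `timeDerivWithin`
(`dT_eq_timeDerivWithin`); on an open `S` it is the two-sided derivative (`dT_of_isOpen`). [folklore] -/
def dT (S : Set ℝ) (u : ℝ → ℝ → ℝ → ℝ) (t x y : ℝ) : ℝ :=
  derivWithin (fun s => u s x y) S t

/-- Unfolding `lap`. [folklore] -/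
theorem lap_apply (f : ℝ → ℝ → ℝ) (x y : ℝ) : lap f x y = dX (dX f) x y + dY (dY f) x y := rfl

/-- `dT` is the tree's `timeDerivWithin` of the field uncurried in space (definitionally). [folklore] -/
theorem dT_eq_timeDerivWithin (S : Set ℝ) (u : ℝ → ℝ → ℝ → ℝ) (t x y : ℝ) :
    dT S u t x y = timeDerivWithin S (fun s (q : ℝ × ℝ) => u s q.1 q.2) t (x, y) := rfl

/-- On an open time set the one-sided time derivative is the ordinary one (Mathlib
`derivWithin_of_isOpen`). [folklore] -/
theorem dT_of_isOpen {S : Set ℝ} (hS : IsOpen S) (u : ℝ → ℝ → ℝ → ℝ) {t : ℝ} (ht : t ∈ S)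
    (x y : ℝ) : dT S u t x y = deriv (fun s => u s x y) t :=
  derivWithin_of_isOpen hS ht

/-- `∂ₓ 0 = 0`. [folklore] -/
@[simp] theorem dX_zero : dX 0 = 0 := by funext x y; simp [dX]

/-- `∂_y 0 = 0`. [folklore] -/
@[simp] theorem dY_zero : dY 0 = 0 := by funext x y; simp [dY]

/-- `Δ 0 = 0`. [folklore] -/
@[simp] theorem lap_zero : lap 0 = 0 := by funext x y; simp [lap]

/-- Constants have no `x`-derivative. [folklore] -/
@[simp] theorem dX_const (c : ℝ) : dX (fun _ _ => c) = 0 := by funext x y; simp [dX]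

/-- Constants have no `y`-derivative. [folklore] -/
@[simp] theorem dY_const (c : ℝ) : dY (fun _ _ => c) = 0 := by funext x y; simp [dY]

/-- An `x`-independent field has `∂ₓ = 0`. [folklore] -/
@[simp] theorem dX_indep (g : ℝ → ℝ) : dX (fun _ y => g y) = 0 := by funext x y; simp [dX]

/-- An `x`-independent field has `∂_y = g'`. [folklore] -/
@[simp] theorem dY_indep (g : ℝ → ℝ) : dY (fun _ y => g y) = fun _ y => deriv g y := rfl

/-- A time-independent field has `∂ₜ = 0` (within any time set). [folklore] -/
@[simp] theorem dT_const (S : Set ℝ) (g : ℝ → ℝ → ℝ) (t x y : ℝ) : dT S (fun _ => g) t x y = 0 := by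
  simp [dT]

/-- Time slices of a field that is `Cⁿ` jointly on `S × ℝ²` are `Cⁿ` on `ℝ²` (`t ∈ S`). [folklore] -/
theorem contDiff_slice {S : Set ℝ} {u : ℝ → ℝ → ℝ → ℝ} {n : WithTop ℕ∞}
    (hu : ContDiffOn ℝ n (fun q : ℝ × ℝ × ℝ => u q.1 q.2.1 q.2.2) (S ×ˢ univ)) {t : ℝ}
    (ht : t ∈ S) : ContDiff ℝ n (fun q : ℝ × ℝ => u t q.1 q.2) :=
  hu.comp_contDiff (contDiff_const.prodMk contDiff_id) fun q => mk_mem_prod ht (mem_univ q)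

/-- Time lines `s ↦ u s x y` of a field that is `Cⁿ`, `n ≠ 0`, jointly on `S × ℝ²` are differentiable
within `S` (chain rule with `s ↦ (s, x, y)`). [folklore] -/
theorem differentiableWithinAt_time {S : Set ℝ} {u : ℝ → ℝ → ℝ → ℝ} {n : WithTop ℕ∞}
    (hu : ContDiffOn ℝ n (fun q : ℝ × ℝ × ℝ => u q.1 q.2.1 q.2.2) (S ×ˢ univ)) (hn : n ≠ 0)
    {t : ℝ} (ht : t ∈ S) (x y : ℝ) : DifferentiableWithinAt ℝ (fun s => u s x y) S t := by
  have h1 : DifferentiableWithinAt ℝ (fun q : ℝ × ℝ × ℝ => u q.1 q.2.1 q.2.2) (S ×ˢ univ)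
      (t, x, y) :=
    (hu (t, x, y) (mk_mem_prod ht (mem_univ _))).differentiableWithinAt hn
  have h2 : DifferentiableWithinAt ℝ (fun s : ℝ => ((s, x, y) : ℝ × ℝ × ℝ)) S t :=
    differentiableWithinAt_id.prodMk (differentiableWithinAt_const _)
  exact h1.comp t h2 fun s hs => mk_mem_prod hs (mem_univ _)

/-- On a smaller time set of unique differentiability the one-sided time derivative of a jointly
`Cⁿ` (`n ≠ 0`) field is unchanged (Mathlib `HasDerivWithinAt.mono`, `.derivWithin`). [folklore] -/
theorem dT_eq_of_subset {S S' : Set ℝ} {u : ℝ → ℝ → ℝ → ℝ} {n : WithTop ℕ∞}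
    (hu : ContDiffOn ℝ n (fun q : ℝ × ℝ × ℝ => u q.1 q.2.1 q.2.2) (S ×ˢ univ)) (hn : n ≠ 0)
    (hS' : S' ⊆ S) (hU : UniqueDiffOn ℝ S') {t : ℝ} (ht : t ∈ S') (x y : ℝ) :
    dT S' u t x y = dT S u t x y :=
  (((differentiableWithinAt_time hu hn (hS' ht) x y).hasDerivWithinAt).mono hS').derivWithin
    (hU t ht)

end StretchedLayer

open StretchedLayer

/-! ### The solution class -/

/-- **Classical solutions of the stretched two-dimensional Navier–Stokes system of a strained shear
layer** on the time set `S ⊆ ℝ` (viscosity `ν`, strain rate `γ`, velocity jump `ΔU`, period `L`):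
`u v p : ℝ → ℝ → ℝ → ℝ` (`u t x y`), `u, v` of class `C²` and `p` of class `C¹` jointly on
`S × ℝ²`, satisfying pointwise on `S × ℝ²` (one-sided `∂ₜ` within `S`)
`∂ₜu + u∂ₓu + (v − γy)∂_yu = −∂ₓp + νΔu`, `∂ₜv + u∂ₓv + (v − γy)∂_yv − γv = −∂_yp + νΔv`,
`∂ₓu + ∂_yv = 0`, all three fields `L`-periodic in `x`, and the shear-layer far field
`u(t,x,y) → ±ΔU/2`, `v(t,x,y) → 0` as `y → ±∞` for every `t ∈ S` and `x`. This is the exact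
reduction `V = (u, v − γy, γz)`, `P = p − γ²(y²+z²)/2` of 3-D Navier–Stokes in the strain
`(0, −γy, γz)` (module docstring): the `x`-independent members are Majda–Bertozzi's strained shear
layers (§1.4, (1.34)), the PDE in vorticity form is Kerr 2024, (2.1) (there with decaying velocity,
`ΔU = 0`), and the shear far field is Beronov–Kida's (1996, §II) setting.
[cite: MajdaBertozzi2002, §1.4 eqs. (1.26), (1.34)–(1.35), Examples 1.7–1.8] -/
structure IsStretchedLayerNSSolutionOn (S : Set ℝ) (ν γ ΔU L : ℝ) (u v p : ℝ → ℝ → ℝ → ℝ) :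
    Prop where
  /-- `u` is `C²` jointly in `(t, x, y) ∈ S × ℝ²`. -/
  contDiffOn_u : ContDiffOn ℝ 2 (fun q : ℝ × ℝ × ℝ => u q.1 q.2.1 q.2.2) (S ×ˢ univ)
  /-- `v` is `C²` jointly in `(t, x, y) ∈ S × ℝ²`. -/
  contDiffOn_v : ContDiffOn ℝ 2 (fun q : ℝ × ℝ × ℝ => v q.1 q.2.1 q.2.2) (S ×ˢ univ)
  /-- `p` is `C¹` jointly in `(t, x, y) ∈ S × ℝ²`. -/
  contDiffOn_p : ContDiffOn ℝ 1 (fun q : ℝ × ℝ × ℝ => p q.1 q.2.1 q.2.2) (S ×ˢ univ)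
  /-- `x`-momentum: `∂ₜu + u∂ₓu + (v − γy)∂_yu = −∂ₓp + νΔu` on `S × ℝ²`. -/
  momentum_x : ∀ t ∈ S, ∀ x y : ℝ,
    dT S u t x y + u t x y * dX (u t) x y + (v t x y - γ * y) * dY (u t) x y =
      -dX (p t) x y + ν * lap (u t) x y
  /-- `y`-momentum: `∂ₜv + u∂ₓv + (v − γy)∂_yv − γv = −∂_yp + νΔv` on `S × ℝ²`. -/
  momentum_y : ∀ t ∈ S, ∀ x y : ℝ,
    dT S v t x y + u t x y * dX (v t) x y + (v t x y - γ * y) * dY (v t) x y - γ * v t x y =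
      -dY (p t) x y + ν * lap (v t) x y
  /-- Incompressibility of the planar part: `∂ₓu + ∂_yv = 0` on `S × ℝ²`. -/
  divFree : ∀ t ∈ S, ∀ x y : ℝ, dX (u t) x y + dY (v t) x y = 0
  /-- `u` is `L`-periodic in `x`. -/
  periodic_u : ∀ t ∈ S, ∀ x y : ℝ, u t (x + L) y = u t x y
  /-- `v` is `L`-periodic in `x`. -/
  periodic_v : ∀ t ∈ S, ∀ x y : ℝ, v t (x + L) y = v t x y
  /-- `p` is `L`-periodic in `x`. -/
  periodic_p : ∀ t ∈ S, ∀ x y : ℝ, p t (x + L) y = p t x y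
  /-- Far field above the layer: `u(t, x, y) → ΔU/2` as `y → +∞`. -/
  tendsto_u_atTop : ∀ t ∈ S, ∀ x : ℝ, Tendsto (fun y => u t x y) atTop (𝓝 (ΔU / 2))
  /-- Far field below the layer: `u(t, x, y) → −ΔU/2` as `y → −∞`. -/
  tendsto_u_atBot : ∀ t ∈ S, ∀ x : ℝ, Tendsto (fun y => u t x y) atBot (𝓝 (-(ΔU / 2)))
  /-- `v(t, x, y) → 0` as `y → +∞`. -/
  tendsto_v_atTop : ∀ t ∈ S, ∀ x : ℝ, Tendsto (fun y => v t x y) atTop (𝓝 0)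
  /-- `v(t, x, y) → 0` as `y → −∞`. -/
  tendsto_v_atBot : ∀ t ∈ S, ∀ x : ℝ, Tendsto (fun y => v t x y) atBot (𝓝 0)

/-- **Steady solutions of the stretched two-dimensional Navier–Stokes system** (time-independent
`u v p : ℝ → ℝ → ℝ`, `u x y`): `u, v ∈ C²(ℝ²)`, `p ∈ C¹(ℝ²)`,
`u∂ₓu + (v − γy)∂_yu = −∂ₓp + νΔu`, `u∂ₓv + (v − γy)∂_yv − γv = −∂_yp + νΔv`, `∂ₓu + ∂_yv = 0`,
`L`-periodic in `x`, far field `u → ±ΔU/2`, `v → 0`; equivalently the time-dependent class on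
`S = univ` at constant fields (`isSteadyStretchedLayerNSSolution_iff_const`). With `ΔU = 0` this is
the steady `x`-periodic problem of Kerr–Dold's vortices in the stagnation-point flow `(0, −γy, γz)`
(Kerr 2024, §2, (2.1)–(2.3), in vorticity–stream-function form); with `ΔU ≠ 0` the steady states of
the strained shear layer (Majda–Bertozzi 2002, (1.47)–(1.48)). [cite: Kerr2024, §2 eqs. (2.1)–(2.4)] -/
structure IsSteadyStretchedLayerNSSolution (ν γ ΔU L : ℝ) (u v p : ℝ → ℝ → ℝ) : Prop where
  /-- `u ∈ C²(ℝ²)`. -/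
  contDiff_u : ContDiff ℝ 2 (fun q : ℝ × ℝ => u q.1 q.2)
  /-- `v ∈ C²(ℝ²)`. -/
  contDiff_v : ContDiff ℝ 2 (fun q : ℝ × ℝ => v q.1 q.2)
  /-- `p ∈ C¹(ℝ²)`. -/
  contDiff_p : ContDiff ℝ 1 (fun q : ℝ × ℝ => p q.1 q.2)
  /-- Steady `x`-momentum. -/
  momentum_x : ∀ x y : ℝ,
    u x y * dX u x y + (v x y - γ * y) * dY u x y = -dX p x y + ν * lap u x y
  /-- Steady `y`-momentum. -/
  momentum_y : ∀ x y : ℝ,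
    u x y * dX v x y + (v x y - γ * y) * dY v x y - γ * v x y = -dY p x y + ν * lap v x y
  /-- `∂ₓu + ∂_yv = 0`. -/
  divFree : ∀ x y : ℝ, dX u x y + dY v x y = 0
  /-- `u` is `L`-periodic in `x`. -/
  periodic_u : ∀ x y : ℝ, u (x + L) y = u x y
  /-- `v` is `L`-periodic in `x`. -/
  periodic_v : ∀ x y : ℝ, v (x + L) y = v x y
  /-- `p` is `L`-periodic in `x`. -/
  periodic_p : ∀ x y : ℝ, p (x + L) y = p x y
  /-- `u(x, y) → ΔU/2` as `y → +∞`. -/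
  tendsto_u_atTop : ∀ x : ℝ, Tendsto (fun y => u x y) atTop (𝓝 (ΔU / 2))
  /-- `u(x, y) → −ΔU/2` as `y → −∞`. -/
  tendsto_u_atBot : ∀ x : ℝ, Tendsto (fun y => u x y) atBot (𝓝 (-(ΔU / 2)))
  /-- `v(x, y) → 0` as `y → +∞`. -/
  tendsto_v_atTop : ∀ x : ℝ, Tendsto (fun y => v x y) atTop (𝓝 0)
  /-- `v(x, y) → 0` as `y → −∞`. -/
  tendsto_v_atBot : ∀ x : ℝ, Tendsto (fun y => v x y) atBot (𝓝 0)

variable {S S' : Set ℝ} {ν γ ΔU L : ℝ} {u v p : ℝ → ℝ → ℝ → ℝ}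

/-- The time slices `u t`, `t ∈ S`, are `C²` on `ℝ²`. [folklore] -/
theorem IsStretchedLayerNSSolutionOn.contDiff_u (h : IsStretchedLayerNSSolutionOn S ν γ ΔU L u v p)
    {t : ℝ} (ht : t ∈ S) : ContDiff ℝ 2 (fun q : ℝ × ℝ => u t q.1 q.2) :=
  contDiff_slice h.contDiffOn_u ht

/-- The time slices `v t`, `t ∈ S`, are `C²` on `ℝ²`. [folklore] -/
theorem IsStretchedLayerNSSolutionOn.contDiff_v (h : IsStretchedLayerNSSolutionOn S ν γ ΔU L u v p)
    {t : ℝ} (ht : t ∈ S) : ContDiff ℝ 2 (fun q : ℝ × ℝ => v t q.1 q.2) :=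
  contDiff_slice h.contDiffOn_v ht

/-- The time slices `p t`, `t ∈ S`, are `C¹` on `ℝ²`. [folklore] -/
theorem IsStretchedLayerNSSolutionOn.contDiff_p (h : IsStretchedLayerNSSolutionOn S ν γ ΔU L u v p)
    {t : ℝ} (ht : t ∈ S) : ContDiff ℝ 1 (fun q : ℝ × ℝ => p t q.1 q.2) :=
  contDiff_slice h.contDiffOn_p ht

/-- **Restriction of the time set**: a solution on `S` is a solution on any `S' ⊆ S` of unique
differentiability (`S'` open, or a non-degenerate interval); needed because the one-sided `∂ₜ`
depends on the time set (cf. `IsClassicalNSSolutionOn.mono`). [folklore] -/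
theorem IsStretchedLayerNSSolutionOn.mono (h : IsStretchedLayerNSSolutionOn S ν γ ΔU L u v p)
    (hS' : S' ⊆ S) (hU : UniqueDiffOn ℝ S') : IsStretchedLayerNSSolutionOn S' ν γ ΔU L u v p where
  contDiffOn_u := h.contDiffOn_u.mono (prod_mono hS' Subset.rfl)
  contDiffOn_v := h.contDiffOn_v.mono (prod_mono hS' Subset.rfl)
  contDiffOn_p := h.contDiffOn_p.mono (prod_mono hS' Subset.rfl)
  momentum_x t ht x y := by
    rw [dT_eq_of_subset h.contDiffOn_u two_ne_zero hS' hU ht x y]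
    exact h.momentum_x t (hS' ht) x y
  momentum_y t ht x y := by
    rw [dT_eq_of_subset h.contDiffOn_v two_ne_zero hS' hU ht x y]
    exact h.momentum_y t (hS' ht) x y
  divFree t ht := h.divFree t (hS' ht)
  periodic_u t ht := h.periodic_u t (hS' ht)
  periodic_v t ht := h.periodic_v t (hS' ht)
  periodic_p t ht := h.periodic_p t (hS' ht)
  tendsto_u_atTop t ht := h.tendsto_u_atTop t (hS' ht)
  tendsto_u_atBot t ht := h.tendsto_u_atBot t (hS' ht)
  tendsto_v_atTop t ht := h.tendsto_v_atTop t (hS' ht)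
  tendsto_v_atBot t ht := h.tendsto_v_atBot t (hS' ht)

/-- A plane field is `Cⁿ` iff, viewed as a time-independent space–time field, it is `Cⁿ` jointly on
`univ × ℝ²`. [folklore] -/
theorem StretchedLayer.contDiffOn_const_time_iff {n : WithTop ℕ∞} (g : ℝ → ℝ → ℝ) :
    ContDiffOn ℝ n (fun q : ℝ × ℝ × ℝ => g q.2.1 q.2.2) ((univ : Set ℝ) ×ˢ (univ : Set (ℝ × ℝ))) ↔
      ContDiff ℝ n (fun q : ℝ × ℝ => g q.1 q.2) := by
  rw [univ_prod_univ, contDiffOn_univ]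
  constructor
  · intro h
    exact h.comp (contDiff_const.prodMk contDiff_id : ContDiff ℝ n fun q : ℝ × ℝ => ((0 : ℝ), q))
  · intro h
    exact h.comp contDiff_snd

/-- **Steady = time-independent solution.** `IsSteadyStretchedLayerNSSolution ν γ ΔU L u v p` iff the
constant-in-time fields solve the stretched system on the time set `univ` (the one-sided time
derivative of a constant field is `0`). [folklore] -/
theorem isSteadyStretchedLayerNSSolution_iff_const {u v p : ℝ → ℝ → ℝ} :
    IsSteadyStretchedLayerNSSolution ν γ ΔU L u v p ↔
      IsStretchedLayerNSSolutionOn univ ν γ ΔU L (fun _ => u) (fun _ => v) (fun _ => p) := by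
  constructor
  · intro h
    exact
      { contDiffOn_u := (StretchedLayer.contDiffOn_const_time_iff u).2 h.contDiff_u
        contDiffOn_v := (StretchedLayer.contDiffOn_const_time_iff v).2 h.contDiff_v
        contDiffOn_p := (StretchedLayer.contDiffOn_const_time_iff p).2 h.contDiff_p
        momentum_x := fun t _ x y => by rw [dT_const, zero_add]; exact h.momentum_x x y
        momentum_y := fun t _ x y => by rw [dT_const, zero_add]; exact h.momentum_y x y
        divFree := fun _ _ => h.divFree
        periodic_u := fun _ _ => h.periodic_u
        periodic_v := fun _ _ => h.periodic_v
        periodic_p := fun _ _ => h.periodic_p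
        tendsto_u_atTop := fun _ _ => h.tendsto_u_atTop
        tendsto_u_atBot := fun _ _ => h.tendsto_u_atBot
        tendsto_v_atTop := fun _ _ => h.tendsto_v_atTop
        tendsto_v_atBot := fun _ _ => h.tendsto_v_atBot }
  · intro h
    have h0 : (0 : ℝ) ∈ (univ : Set ℝ) := mem_univ _
    exact
      { contDiff_u := (StretchedLayer.contDiffOn_const_time_iff u).1 h.contDiffOn_u
        contDiff_v := (StretchedLayer.contDiffOn_const_time_iff v).1 h.contDiffOn_v
        contDiff_p := (StretchedLayer.contDiffOn_const_time_iff p).1 h.contDiffOn_p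
        momentum_x := fun x y => by
          have := h.momentum_x 0 h0 x y
          rwa [dT_const, zero_add] at this
        momentum_y := fun x y => by
          have := h.momentum_y 0 h0 x y
          rwa [dT_const, zero_add] at this
        divFree := h.divFree 0 h0
        periodic_u := h.periodic_u 0 h0
        periodic_v := h.periodic_v 0 h0
        periodic_p := h.periodic_p 0 h0
        tendsto_u_atTop := h.tendsto_u_atTop 0 h0
        tendsto_u_atBot := h.tendsto_u_atBot 0 h0
        tendsto_v_atTop := h.tendsto_v_atTop 0 h0
        tendsto_v_atBot := h.tendsto_v_atBot 0 h0 }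

/-! ### Dissipation per unit area of the layer -/

/-- **Dissipation per unit layer area** of a time slice `(u, v)` (plane fields `u x y`, `v x y`):
`(ν/L) ∫⁻_{x ∈ (0, L]} ∫⁻_{y ∈ ℝ} (uₓ² + u_y² + vₓ² + v_y²) ∈ [0, ∞]` — the viscous dissipation
`ν|∇V|²` of `V = (u, v − γy, γz)` per period and per unit length in `z`, in excess of the uniform
strain's `2νγ²` (up to the term `−2νγ∫∫v_y = 0` for the class's far field). An extended real: no
integrability is presupposed. [folklore] -/
def layerDissipation (ν L : ℝ) (u v : ℝ → ℝ → ℝ) : ℝ≥0∞ :=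
  ENNReal.ofReal (ν / L) *
    ∫⁻ x in Ioc 0 L, ∫⁻ y, ENNReal.ofReal (dX u x y ^ 2 + dY u x y ^ 2 + dX v x y ^ 2 + dY v x y ^ 2)

/-- Unfolding `layerDissipation`. [folklore] -/
theorem layerDissipation_def (ν L : ℝ) (u v : ℝ → ℝ → ℝ) :
    layerDissipation ν L u v = ENNReal.ofReal (ν / L) * ∫⁻ x in Ioc 0 L, ∫⁻ y,
      ENNReal.ofReal (dX u x y ^ 2 + dY u x y ^ 2 + dX v x y ^ 2 + dY v x y ^ 2) := rfl

/-- **Long-time (Cesàro) mean dissipation per unit area**, as a lower limit: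
`liminf_{T → ∞} T⁻¹ ∫₀ᵀ layerDissipation ν L (u t) (v t) dt ∈ [0, ∞]` for time-dependent fields
`u v : ℝ → ℝ → ℝ → ℝ` (the quantity bounded below in the route's strained-layer law). [folklore] -/
def meanLayerDissipation (ν L : ℝ) (u v : ℝ → ℝ → ℝ → ℝ) : ℝ≥0∞ :=
  liminf (fun T : ℝ => ENNReal.ofReal T⁻¹ * ∫⁻ t in Ioc 0 T, layerDissipation ν L (u t) (v t)) atTop

/-- Unfolding `meanLayerDissipation`. [folklore] -/
theorem meanLayerDissipation_def (ν L : ℝ) (u v : ℝ → ℝ → ℝ → ℝ) :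
    meanLayerDissipation ν L u v = liminf (fun T : ℝ => ENNReal.ofReal T⁻¹ *
      ∫⁻ t in Ioc 0 T, layerDissipation ν L (u t) (v t)) atTop := rfl

/-! ### The Burgers shear layer as a member of the class -/

/-- The **Burgers shear layer** as a time-dependent plane field: `(t, x, y) ↦ U_B(y)` with
`U_B = burgersLayerProfile γ ν ΔU`, i.e. `U_B(y) = (ΔU/√π) ∫₀^{y(γ/2ν)^{1/2}} e^{−s²} ds
= ΔU (γ/2πν)^{1/2} ∫₀^y e^{−γs²/2ν} ds` (Majda–Bertozzi 2002, (1.48), centred so that `U_B` is odd);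
steady and `x`-independent. [cite: MajdaBertozzi2002, §1.4 Example 1.8 eq. (1.48)] -/
def burgersShearLayer (γ ν ΔU : ℝ) : ℝ → ℝ → ℝ → ℝ :=
  fun _ _ y => burgersLayerProfile γ ν ΔU y

/-- Unfolding `burgersShearLayer`. [folklore] -/
@[simp] theorem burgersShearLayer_apply (γ ν ΔU t x y : ℝ) :
    burgersShearLayer γ ν ΔU t x y = burgersLayerProfile γ ν ΔU y := rfl

end Literature.Analysis.FluidPDE
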